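import Summits.AtomisticToContinuum.Crystallization.Theses.NashClassCertificates
import Summits.AtomisticToContinuum.Crystallization.Theses.SpectralChargeLedger
import Summits.AtomisticToContinuum.Crystallization.Theorems.PhononSlackCertificatesPeriodicGivenLayered

/-!
# `PeriodicGivenLayered` — shared crux stmt-AtomisticToContinuum-17658, routes `NashClassCertificates` and
# `SpectralChargeLedger` (line `Sketch` = proved-twin-by-name)

The item is the character-for-character twin of the shared item stmt-AtomisticToContinuum-11779
(`PhononSlackCertificates.PeriodicGivenLayered` = `HullMinimality.PeriodicGivenLayered`), PROVED in tree by
`Summit.AtomisticToContinuum.Crystallization.Theorems.LayeredHull.PeriodicGivenLayered_of`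
(`Theorems/PhononSlackCertificatesPeriodicGivenLayered.lean`, recurrent-limit density closing: extraction →
recurrence → window bounds / registry / convexity / layer cake → closing → read-off). The four route decls are
definitionally equal, so both copies of the crux are closed BY NAME with that one landed term. The ground-state
hypothesis is used (inside `LayeredHull.stub_closing`), as the standing disproof requires
(`Cruxes/PeriodicGivenLayered/Disproof.lean: periodicGivenLayered_false_without_groundState`,
`…_false_without_groundState_constSpacing`, `not_periodicGivenLayeredFor_zero`).

This file imports the two route files and the proof module; nothing is imported INTO the route files, so their
module cones are unchanged (the reason the planners kept the statement as a hypothesis of `closes`).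
-/

namespace Summit.AtomisticToContinuum.Crystallization.Theorems.NashPeriodicGivenLayered

/-- **Crux `PeriodicGivenLayered` of route `NashClassCertificates`** (shared item stmt-AtomisticToContinuum-17658):
for every sequence of Lennard-Jones ground states, layered windows at every scale (one in-layer spacing
`a ∈ [47/50, 1]`, free Hägg word, free interlayer spacings in `[39a/50, 17a/20]`, a rigid motion per window) imply
periodic windows at every scale (one `PeriodicConfiguration 3`, translations only). Closed by the proved twin
stmt-AtomisticToContinuum-11779, `LayeredHull.PeriodicGivenLayered_of` — the two statements agree verbatim.
[cite: BlancLewin2015, §5] [folklore] -/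
theorem periodicGivenLayered_proof :
    Summit.AtomisticToContinuum.Crystallization.Theses.NashClassCertificates.PeriodicGivenLayered := by
  unfold Summit.AtomisticToContinuum.Crystallization.Theses.NashClassCertificates.PeriodicGivenLayered
  exact LayeredHull.PeriodicGivenLayered_of

/-- **Crux `PeriodicGivenLayered` of route `SpectralChargeLedger`** (the same shared item
stmt-AtomisticToContinuum-17658, the same statement verbatim): layered windows at every scale imply periodic
windows at every scale for every sequence of Lennard-Jones ground states. Closed by the proved twin
`LayeredHull.PeriodicGivenLayered_of`. [cite: BlancLewin2015, §5] [folklore] -/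
theorem spectralChargeLedger_periodicGivenLayered_proof :
    Summit.AtomisticToContinuum.Crystallization.Theses.SpectralChargeLedger.PeriodicGivenLayered := by
  unfold Summit.AtomisticToContinuum.Crystallization.Theses.SpectralChargeLedger.PeriodicGivenLayered
  exact LayeredHull.PeriodicGivenLayered_of

end Summit.AtomisticToContinuum.Crystallization.Theorems.NashPeriodicGivenLayered
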